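import Literature.AnabelianGeometry.EtaleTheta.Discharge.Sec3Thm37SubQFT
import HarnessLib

/-!
# [EtTh] Theorem 3.7 (i)/(iv) — the data hypothesis `hB` discharged (`B₀^Λ` is group-like by definition)

Proof-only sequel of `Discharge/Sec3Thm37.lean` (abc-iut-L6-t13), `Sec3Thm37Named.lean`, `Sec3Thm37SubQFT.lean`
(S. Mochizuki, *The étale theta function …*, Publ. RIMS **45** (2009) [EtTh], §3, Thm. 3.7 pp. 79–80 = PDF
pp. 305–306 of `paper:doi-10-2977-prims-1234361159`). Those files carry the hypothesis
`hB : ∀ Y b, IsUnit b` ("`B₀ ⊆ K^×` is a group-like monoid", Def 3.3 (iii) / Def 3.6 (i)); since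
`TemperedFrobenioid.lean` v2 (abc-iut-L2-t3, p410405) the datum `RealifiedDivisorMonoids` RECORDS it as the field
`isUnit_BΛ`, so every `hB` is now `T.isUnit_BΛ`. Here: the `hB`-free forms — Thm 3.7 (i) "of isotropic type"
UNCONDITIONALLY; "of sub-quasi-Frobenius-trivial type" and the tree-vocabulary clauses of (i) modulo `hF`
([FrdI] Thm 5.2 (ii)) only; (iv) "`D` slim ⟹ `C` slim" modulo `hF` and `hdiv` (`⋂ₙ O^×(A)ⁿ = 1`); and at the
canonical vocabulary `treeCatVocab` modulo the single residual datum `hBmon : IsMonoidOn B` (and `hdiv`).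
HONEST FRAMING: refereed pre-IUT material; nothing here bears on [IUTchIII] Cor. 3.12.
-/

namespace Literature.AnabelianGeometry.EtaleTheta

open CategoryTheory Opposite Literature.AlgebraicGeometry.Frobenioids

universe u₀ v₀ u v w

variable {D₀ : Type u₀} [Category.{v₀} D₀] {V : FrdIMonoidStub.{w}}
  {T : RealifiedDivisorMonoids (D₀ := D₀) V} {D : Type u} [Category.{v} D]

namespace TemperedFrobenioid

section General

variable {VD : FrdICatStub.{u, v, w} D} (C₀ : TemperedFrobenioid T D VD)

/-- The rational-function monoid `B = B₀^Λ|_D ×_{(Φ^{ℝ-log})^gp} Φ^gp` is objectwise group-like — now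
UNCONDITIONAL (`hB := T.isUnit_BΛ`). [cite: MochizukiEtTh2009, Def 3.6 p.77] -/
theorem ratFnFunctor_isGroupLike_holds :
    Objectwise (fun M _ => IsGroupLike M) C₀.ratFnFunctor :=
  C₀.ratFnFunctor_isGroupLike T.isUnit_BΛ

/-- **Thm 3.7 (i), "of isotropic type" — UNCONDITIONAL** ([FrdI] Thm 5.2 (ii) `ModelFrobenioid.isIsotropic`
with `B` group-like by `isUnit_BΛ`). [cite: MochizukiEtTh2009, Thm 3.7 p.79] -/
theorem thm37_i_isotropic_holds : PreFrobenioid.IsOfIsotropicType C₀.toElem :=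
  C₀.thm37_i_isotropic T.isUnit_BΛ

/-- **Thm 3.7 (i), "of sub-quasi-Frobenius-trivial type"** modulo `hF` only ([FrdI] Prop 1.10 (vi)).
[cite: MochizukiEtTh2009, Thm 3.7 p.79] -/
theorem thm37_i_subQuasiFrobeniusTrivial_of_isFrobenioid (hF : PreFrobenioid.IsFrobenioid C₀.toElem) :
    PreFrobenioid.IsOfType (PreFrobenioid.IsSubQuasiFrobeniusTrivial C₀.toElem) :=
  C₀.thm37_i_subQuasiFrobeniusTrivial hF T.isUnit_BΛ

/-- The three tree-vocabulary conjuncts of Thm 3.7 (i) ("isotropic", "sub-quasi-Frobenius-trivial", "not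
group-like") modulo `hF` only. [cite: MochizukiEtTh2009, Thm 3.7 p.79] -/
theorem thm37_i_treeClauses_of_isFrobenioid (hF : PreFrobenioid.IsFrobenioid C₀.toElem) :
    PreFrobenioid.IsOfIsotropicType C₀.toElem ∧
      PreFrobenioid.IsOfType (PreFrobenioid.IsSubQuasiFrobeniusTrivial C₀.toElem) ∧
      ¬ PreFrobenioid.IsOfType (PreFrobenioid.IsGroupLikeObj C₀.toElem) :=
  C₀.thm37_i_treeClauses hF T.isUnit_BΛ

/-- **Thm 3.7 (iv)** "`D` slim ⟹ `C` slim" modulo `hF` ([FrdI] Thm 5.2 (ii)) and `hdiv` (`⋂ₙ O^×(A)ⁿ = 1`)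
only. [cite: MochizukiEtTh2009, Thm 3.7 p.80] -/
theorem isSlim_category_of_isFrobenioid (hF : PreFrobenioid.IsFrobenioid C₀.toElem)
    (hdiv : ∀ (X : C₀.category) (α : Aut X), α ∈ PreFrobenioid.unitsSubgroup C₀.toElem X →
      (∀ n : ℕ+, ∃ β : Aut X, β ∈ PreFrobenioid.unitsSubgroup C₀.toElem X ∧ β ^ (n : ℕ) = α) → α = 1)
    (hD : IsSlim D) : IsSlim C₀.category :=
  C₀.isSlim_category hF T.isUnit_BΛ hdiv hD

/-- **Thm 3.7 (iv)** as the named `Prop` `Thm37_iv`, modulo `hF` and `hdiv` only.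
[cite: MochizukiEtTh2009, Thm 3.7 p.80] -/
theorem thm37_iv_of_isFrobenioid (hF : PreFrobenioid.IsFrobenioid C₀.toElem)
    (hdiv : ∀ (X : C₀.category) (α : Aut X), α ∈ PreFrobenioid.unitsSubgroup C₀.toElem X →
      (∀ n : ℕ+, ∃ β : Aut X, β ∈ PreFrobenioid.unitsSubgroup C₀.toElem X ∧ β ^ (n : ℕ) = α) → α = 1) :
    C₀.Thm37_iv :=
  C₀.thm37_iv hF T.isUnit_BΛ hdiv

end General

section TreeVocab

variable {IsRational IsStrictlyRational : (Dᵒᵖ ⥤ CommMonCat.{w}) → Prop}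
  (C₀ : TemperedFrobenioid T D (treeCatVocab D IsRational IsStrictlyRational))

/-- At the canonical vocabulary: `C → F_Φ` IS a Frobenioid ([FrdI] Thm 5.2 (ii)) modulo the single residual
datum `hBmon : IsMonoidOn B` ("`𝔹` a monoid on `D`"). [cite: MochizukiEtTh2009, Def 3.6 p.77] -/
theorem isFrobenioid_treeCatVocab_of_isMonoidOn (hBmon : IsMonoidOn C₀.ratFnFunctor) :
    PreFrobenioid.IsFrobenioid C₀.toElem :=
  C₀.isFrobenioid_treeCatVocab hBmon T.isUnit_BΛ

/-- **Thm 3.7 (i)**, tree-vocabulary conjuncts, at the canonical vocabulary modulo `hBmon` only.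
[cite: MochizukiEtTh2009, Thm 3.7 p.79] -/
theorem thm37_i_treeClauses_treeCatVocab_of_isMonoidOn (hBmon : IsMonoidOn C₀.ratFnFunctor) :
    PreFrobenioid.IsOfIsotropicType C₀.toElem ∧
      PreFrobenioid.IsOfType (PreFrobenioid.IsSubQuasiFrobeniusTrivial C₀.toElem) ∧
      ¬ PreFrobenioid.IsOfType (PreFrobenioid.IsGroupLikeObj C₀.toElem) :=
  C₀.thm37_i_treeClauses_treeCatVocab hBmon T.isUnit_BΛ

/-- **Thm 3.7 (iv)** (named `Prop` `Thm37_iv`) at the canonical vocabulary modulo `hBmon` and `hdiv` only.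
[cite: MochizukiEtTh2009, Thm 3.7 p.80] -/
theorem thm37_iv_treeCatVocab_of_isMonoidOn (hBmon : IsMonoidOn C₀.ratFnFunctor)
    (hdiv : ∀ (X : C₀.category) (α : Aut X), α ∈ PreFrobenioid.unitsSubgroup C₀.toElem X →
      (∀ n : ℕ+, ∃ β : Aut X, β ∈ PreFrobenioid.unitsSubgroup C₀.toElem X ∧ β ^ (n : ℕ) = α) → α = 1) :
    C₀.Thm37_iv :=
  C₀.thm37_iv_treeCatVocab hBmon T.isUnit_BΛ hdiv

end TreeVocab

end TemperedFrobenioid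

end Literature.AnabelianGeometry.EtaleTheta
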